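import Mathlib
import Summits.Ventures.PercRepro2.TypedTwoTerminalSpine
import Summits.Ventures.PercRepro2.TypedRootBundle

/-!
# The root-bundle rule as a layer of the spine, together with the two-terminal rule (blind cell
PercRepro2, p2 g3, 2026-08-25)

A ROOT BUNDLE of a typed graph: a set `I` of unmarked vertices attached to the rest at the two roots
and one more vertex `v`, through at least three typed edges (`RootBundlePart`, `HasRootBundle`; a
hat is the case `I = {u}`). By `typedCount_rootBundle` such an instance is a nonnegative integer
combination of instances with fewer typed edges, so — by the same strong induction on `#F` through
the bounded spine as for the two-terminal rule — row 2′TRI on the core instances without a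
two-terminal part and without a root bundle gives it on every core instance:
**`HCov_all_of_residualCoreTB_all : ResidualCoreTB_all R → HCov_all R`** (unconditional). Tool:
`typedCount_mixed_of_le_three` — the typed edges of type `0` / `3` of a reduced instance are pinned
closed / open, so every reduced instance is a mixed instance of support `≤ #F − 1`.
-/

namespace Summit.Ventures.PercRepro2

namespace CovForm

namespace TypedRed

open TwoTerm Restrict RootBundle

/-! ## Pinning the non-mixed types -/

section Mixed

variable {E : Type*} [Fintype E] [DecidableEq E] {R : Type*} [CommRing R]

/-- The pinning that opens the typed edges of type `3` and closes those of type `0`. -/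
def pinNonMixed (F : Finset E) (z : Config E) (τ : E → ℕ) : Config E :=
  fun e => if e ∈ F ∧ τ e = 3 then true else if e ∈ F ∧ τ e = 0 then false else z e

/-- The mixed part of a typed set. -/
def mixedPart (F : Finset E) (τ : E → ℕ) : Finset E := F.filter fun e => τ e = 1 ∨ τ e = 2

omit [Fintype E] [DecidableEq E] in
/-- Membership in the mixed part. -/
lemma mem_mixedPart {F : Finset E} {τ : E → ℕ} {e : E} :
    e ∈ mixedPart F τ ↔ e ∈ F ∧ (τ e = 1 ∨ τ e = 2) := by
  simp [mixedPart]

/-- **A typed edge of type `0` or `3` is a pinned edge**: the typed count over `F` with types `≤ 3`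
is the typed count over the mixed part with the non-mixed edges pinned. -/
theorem typedCount_mixed_of_le_three (F : Finset E) (z : Config E) (τ : E → ℕ)
    (hτ : ∀ e ∈ F, τ e ≤ 3) (K : Config E → Config E → Config E → R) :
    typedCount F z τ K = typedCount (mixedPart F τ) (pinNonMixed F z τ) τ K := by
  induction F using Finset.strongInduction generalizing z with
  | H F ih =>
  by_cases h : ∃ f ∈ F, τ f = 0 ∨ τ f = 3
  · obtain ⟨f, hfF, hf⟩ := h
    have hsub : F.erase f ⊂ F := Finset.erase_ssubset hfF
    have hτ' : ∀ e ∈ F.erase f, τ e ≤ 3 := fun e he => hτ e (Finset.mem_of_mem_erase he)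
    have hmixed : mixedPart (F.erase f) τ = mixedPart F τ := by
      ext e
      simp only [mem_mixedPart, Finset.mem_erase]
      constructor
      · rintro ⟨⟨_, he⟩, ht⟩; exact ⟨he, ht⟩
      · rintro ⟨he, ht⟩
        refine ⟨⟨fun hef => ?_, he⟩, ht⟩
        subst hef
        rcases hf with hf | hf <;> rcases ht with ht | ht <;> omega
    have hpin : ∀ c : Bool, (c = true ↔ τ f = 3) →
        pinNonMixed (F.erase f) (Function.update z f c) τ = pinNonMixed F z τ := by
      intro c hc
      funext e
      by_cases hef : e = f
      · subst hef
        have hnot : e ∉ F.erase e := Finset.notMem_erase e F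
        rcases hf with hf | hf
        · have hc' : c = false := by
            cases c
            · rfl
            · exact absurd (hc.1 rfl) (by omega)
          simp [pinNonMixed, hnot, hfF, hf, hc']
        · have hc' : c = true := hc.2 hf
          simp [pinNonMixed, hnot, hfF, hf, hc']
      · simp only [pinNonMixed, Finset.mem_erase, ne_eq, hef, not_false_eq_true, true_and,
          Function.update_of_ne hef]
    rcases hf with hf | hf
    · rw [typedCount_type_zero F f hfF z τ hf K, ih (F.erase f) hsub _ hτ', hmixed,
        hpin false (by simp [hf])]
    · rw [typedCount_type_three F f hfF z τ hf K, ih (F.erase f) hsub _ hτ', hmixed,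
        hpin true (by simp [hf])]
  · have hF : mixedPart F τ = F := by
      ext e
      simp only [mem_mixedPart]
      constructor
      · exact fun h' => h'.1
      · intro he
        refine ⟨he, ?_⟩
        have h1 : ¬ (τ e = 0 ∨ τ e = 3) := fun h' => h ⟨e, he, h'⟩
        rw [not_or] at h1
        have h2 := hτ e he
        omega
    rw [hF]
    refine typedCount_congr_z F (fun e he => ?_) τ K
    simp [pinNonMixed, he]

/-- The support of the pinned instance is inside the typed set when the original instance is
pinned closed. -/
lemma support_pinNonMixed_subset (F : Finset E) (τ : E → ℕ) :
    support (mixedPart F τ) (pinNonMixed F (fun _ => false) τ) ⊆ F := by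
  intro e he
  rw [mem_support, mem_mixedPart] at he
  rcases he with ⟨he, _⟩ | he
  · exact he
  · simp only [pinNonMixed] at he
    by_cases h3 : e ∈ F ∧ τ e = 3
    · exact h3.1
    · rw [if_neg h3] at he
      by_cases h0 : e ∈ F ∧ τ e = 0
      · exact h0.1
      · rw [if_neg h0] at he; exact Bool.noConfusion he

end Mixed

/-! ## Root bundles -/

section Part

variable {V : Type*} {E : Type*} [DecidableEq E]

/-- A root bundle: internal unmarked vertices `I`, the terminals `v, a₁, a₂`, at least three typed
edges inside `I ∪ {v, a₁, a₂}`, no other typed edge at a vertex of `I`. -/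
structure RootBundlePart (ends : E → Sym2 V) (o a₁ a₂ a₃ b : V) (F : Finset E) (I : Set V)
    (v : V) (L : Finset E) : Prop where
  v_ext : v ∉ I
  unmarked : ∀ x ∈ I, x ≠ o ∧ x ≠ a₁ ∧ x ≠ a₂ ∧ x ≠ a₃ ∧ x ≠ b
  sub : L ⊆ F
  three_le : 3 ≤ L.card
  ends_in : ∀ e ∈ L, ∀ x ∈ ends e, x ∈ I ∨ x = v ∨ x = a₁ ∨ x = a₂
  closed : ∀ e, e ∉ L → (∃ x ∈ I, x ∈ ends e) → e ∉ F

/-- The typed graph contains a root bundle. -/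
def HasRootBundle (ends : E → Sym2 V) (o a₁ a₂ a₃ b : V) (F : Finset E) : Prop :=
  ∃ (I : Set V) (v : V) (L : Finset E), RootBundlePart ends o a₁ a₂ a₃ b F I v L

end Part

section Core

variable {V : Type*} {E : Type*} [DecidableEq V] [Fintype E] [DecidableEq E]

/-- **The core without two-terminal parts and without root bundles.** -/
structure ResidualCoreTB (ends : E → Sym2 V) (o a₁ a₂ a₃ b : V) (F : Finset E) : Prop where
  core : ResidualCore ends o a₁ a₂ a₃ b F
  no_twoTerminal : ¬ HasTwoTerminalPart ends o a₁ a₂ a₃ b F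
  no_rootBundle : ¬ HasRootBundle ends o a₁ a₂ a₃ b F

end Core

section Closure

variable (R : Type*) [Field R] [LinearOrder R] [IsStrictOrderedRing R]

/-- **Row 2′TRI on `ResidualCoreTB`, over every finite graph.** -/
def ResidualCoreTB_all : Prop :=
  ∀ (V E : Type) [Fintype V] [DecidableEq V] [Fintype E] [DecidableEq E]
    (ends : E → Sym2 V) (o a₁ a₂ a₃ b : V) (F : Finset E) (τ : E → ℕ),
    (∀ e ∈ F, τ e = 1 ∨ τ e = 2) → ResidualCoreTB ends o a₁ a₂ a₃ b F →
      0 ≤ typedCount F (fun _ => false) τ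
        (K3 ends o a₁ a₂ a₃ b : Config E → Config E → Config E → R)

/-- **(TRI) on the core from (TRI) on the core without two-terminal parts and root bundles** — by
strong induction on the number of typed edges: either rule rewrites a core instance into a
nonnegative integer combination of instances with fewer typed edges (types `0` / `3` pinned by
`typedCount_mixed_of_le_three`), each handled by the bounded spine at `#F − 1`. -/
theorem residualCore_all_of_residualCoreTB_all (hc : ResidualCoreTB_all R) :
    ResidualCore_all R := by
  suffices h : ∀ N : ℕ, ∀ (V E : Type) [Fintype V] [DecidableEq V] [Fintype E] [DecidableEq E]
      (ends : E → Sym2 V) (o a₁ a₂ a₃ b : V) (F : Finset E) (τ : E → ℕ),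
      (∀ e ∈ F, τ e = 1 ∨ τ e = 2) → ResidualCore ends o a₁ a₂ a₃ b F → F.card ≤ N →
        0 ≤ typedCount F (fun _ => false) τ
          (K3 ends o a₁ a₂ a₃ b : Config E → Config E → Config E → R) by
    intro V E _ _ _ _ ends o a₁ a₂ a₃ b F τ hτ hres
    exact h F.card V E ends o a₁ a₂ a₃ b F τ hτ hres le_rfl
  intro N
  induction N using Nat.strong_induction_on with
  | _ N ih =>
  intro V E _ _ _ _ ends o a₁ a₂ a₃ b F τ hτ hres hN
  -- the bounded spine at `N - 1`, for every residual instance with `≤ N - 1` typed edges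
  have tower : N - 1 < N → ∀ (E' : Type) [Fintype E'] [DecidableEq E'] (ends' : E' → Sym2 V)
      (o' a₁' a₂' a₃' b' : V) (F' : Finset E') (τ' : E' → ℕ), (∀ e ∈ F', τ' e = 1 ∨ τ' e = 2) →
      ResidualR ends' o' a₁' a₂' a₃' b' F' → F'.card ≤ N - 1 →
        0 ≤ typedCount F' (fun _ => false) τ'
          (K3 ends' o' a₁' a₂' a₃' b' : Config E' → Config E' → Config E' → R) := by
    intro hN1 E' _ _ ends' o' a₁' a₂' a₃' b' F' τ' hτ' hR hcard
    by_cases hcon : Conn ends' (typedConfig F') a₁' a₂'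
    · by_cases hbr : RootBridge.HasRootBridgeSameSide' ends' o' a₁' a₂' b' F'
      · exact RootBridge.typedCount_nonneg_of_hasRootBridgeSameSide' ends' o' a₁' a₂' a₃' b' F'
          τ' hτ' hbr
      by_cases hm : MarksDistinct o' a₁' a₂' a₃' b'
      · exact ih (N - 1) hN1 V E' ends' o' a₁' a₂' a₃' b' F' τ' hτ'
          ⟨⟨⟨hR.residual, hcon⟩, hR.root_reach⟩, hbr, hm⟩ hcard
      · rw [typedCount_eq_zero_of_not_marksDistinct ends' hm]
    · exact Separated.typedCount_nonneg_of_typedConfig_sep ends' o' a₁' a₂' a₃' b' F' τ' hτ' hcon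
  -- a reduced instance: pinned closed, types `≤ 3`, at most `N - 1` typed edges
  have step : N - 1 < N → ∀ (ends' : E → Sym2 V) (F' : Finset E) (τ' : E → ℕ),
      (∀ e ∈ F', τ' e ≤ 3) → F'.card ≤ N - 1 →
        0 ≤ typedCount F' (fun _ => false) τ'
          (K3 ends' o a₁ a₂ a₃ b : Config E → Config E → Config E → R) := by
    intro hN1 ends' F' τ' hτ3 hcard
    rw [typedCount_mixed_of_le_three F' _ τ' hτ3]
    refine typedCount_nonneg_of_residualR_card_le (N - 1) (tower hN1) ends' o a₁ a₂ a₃ b _ _ _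
      (fun e he => (mem_mixedPart.1 he).2) ?_
    exact le_trans (Finset.card_le_card (support_pinNonMixed_subset F' τ')) hcard
  have hz0 : ∀ L : Finset E, offL L (fun _ : E => false) = fun _ => false := fun L => by
    funext e; simp [offL]
  by_cases hT : HasTwoTerminalPart ends o a₁ a₂ a₃ b F
  · obtain ⟨I, s, t, L, hP⟩ := hT
    obtain ⟨h₀, h₀L⟩ : ∃ h₀, h₀ ∈ L := Finset.card_pos.1 (by have := hP.two_le; omega)
    have hLF := Finset.card_le_card hP.sub
    have hN1 : N - 1 < N := by have := hP.two_le; omega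
    have hh₀ : h₀ ∉ F \ L := fun h => (Finset.mem_sdiff.1 h).2 h₀L
    refine typedCount_nonneg_of_twoTerminal ends o a₁ a₂ a₃ b hP.s_ext hP.t_ext hP.unmarked
      hP.ends_in h₀L hP.sub _ τ (fun e he hv => ⟨hP.closed e he hv, rfl⟩) ?_
    intro k hk
    rw [hz0]
    refine step hN1 _ _ _ (fun e he => ?_) ?_
    · rcases Finset.mem_insert.1 he with rfl | he
      · rw [Function.update_self]; exact hk
      · rw [Function.update_of_ne (fun h => hh₀ (by rw [← h]; exact he))]
        rcases hτ e (Finset.mem_sdiff.1 he).1 with h | h <;> omega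
    · rw [Finset.card_insert_of_notMem hh₀, Finset.card_sdiff_of_subset hP.sub]
      have := hP.two_le
      omega
  by_cases hB : HasRootBundle ends o a₁ a₂ a₃ b F
  · obtain ⟨I, v, L, hP⟩ := hB
    obtain ⟨h₁, h₁L, h₂, h₂L, h12⟩ : ∃ h₁ ∈ L, ∃ h₂ ∈ L, h₁ ≠ h₂ :=
      Finset.one_lt_card.1 (by have := hP.three_le; omega)
    have hLF := Finset.card_le_card hP.sub
    have hN1 : N - 1 < N := by have := hP.three_le; omega
    have hh₁ : h₁ ∉ F \ L := fun h => (Finset.mem_sdiff.1 h).2 h₁L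
    have hh₂ : h₂ ∉ insert h₁ (F \ L) := by
      rw [Finset.mem_insert, not_or]
      exact ⟨Ne.symm h12, fun h => (Finset.mem_sdiff.1 h).2 h₂L⟩
    refine typedCount_nonneg_of_rootBundle ends o a₁ a₂ a₃ b hP.v_ext hP.unmarked hP.ends_in
      h₁L h₂L h12 hP.sub _ τ (fun e he hv => ⟨hP.closed e he hv, rfl⟩) ?_
    intro k₁ k₂ hk₁ hk₂
    rw [hz0]
    refine step hN1 _ _ _ (fun e he => ?_) ?_
    · rcases Finset.mem_insert.1 he with rfl | he
      · rw [Function.update_self]; exact hk₂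
      · rw [Function.update_of_ne (fun h => hh₂ (by rw [← h]; exact he))]
        rcases Finset.mem_insert.1 he with rfl | he
        · rw [Function.update_self]; exact hk₁
        · rw [Function.update_of_ne (fun h => hh₁ (by rw [← h]; exact he))]
          rcases hτ e (Finset.mem_sdiff.1 he).1 with h | h <;> omega
    · rw [Finset.card_insert_of_notMem hh₂, Finset.card_insert_of_notMem hh₁,
        Finset.card_sdiff_of_subset hP.sub]
      have := hP.three_le
      omega
  · exact hc V E ends o a₁ a₂ a₃ b F τ hτ ⟨hres, hT, hB⟩

/-- **THE CRUX OF RECORD FROM (TRI) ON THE CORE WITHOUT TWO-TERMINAL PARTS AND WITHOUT ROOT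
BUNDLES** (unconditional). -/
theorem HCov_all_of_residualCoreTB_all (hc : ResidualCoreTB_all R) : HCov_all R :=
  HCov_all_of_residualCore_all R (residualCore_all_of_residualCoreTB_all R hc)

end Closure

end TypedRed

end CovForm

end Summit.Ventures.PercRepro2
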